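import Summits.Langlands.Langlands.Theorems.SplitPrimeDescentLadder

/-!
# SplitPrimeDescentLadder, v3 (RESIDUAL currency) — add-on module to `Theorems.SplitPrimeDescentLadder`

(decomp-langlands cell.  Census-1 g32 twin of the lens-1 g34 node `SplitPrimeDescentLadder` **v3**
(kit `HOME/decomp-langlands-lens-1/g34/v3/SplitPrimeDescentLadder.v3.lean`, sha256 `62ecf388479fb752…`, rc0 · 0 sorry).
The gate's append-only rule forbids mutating the landed v2b module `Theorems.SplitPrimeDescentLadder` (p828535:
removed/changed declarations bounce as `theorems.append-only`), so the NEW content of v3 lands HERE, in the same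
namespace, importing v2b for the unchanged pieces F∞ `ClassicalityOffBadPlaces`, G∞ `UntwistAutomorphyAt`
(PROVED: `untwistAutomorphyAt_proof`), H∞ `CofinalCyclicDescent` (v2: CM clause) and the certificates.  The v2b
declarations D∞ `CofinalSplitDoor`, E∞ `ShapePreservingEngine`, `langlands_of_pieces`, `closes_target` and
`cmOrdinaryDoor_of_cofinalSplitDoor` stay in the tree but are SUPERSEDED by this module: by § Obstruction below,
D∞ (v2b) is FALSE as soon as one admissible `σ` exists and the hypothesis of E∞ (v2b) is unsatisfiable — every v2b
theorem is true, the v2b split is VACUOUS at D∞.  The deciding theorems of v3 are `langlands_of_pieces_residual` and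
`closes_target_residual` below (the lens's `langlands_of_pieces` / `closes_target`, renamed for the same append-only
reason; proofs verbatim).  All prose and all declaration texts below are the lens-1 g34 v3 texts verbatim; the census
added only this paragraph, the import line and the two renames.)

## Obstruction (v3, g34) — why v2's characteristic-0 weight-zero door was unsatisfiable

v2/v2b typed the door's output (and the engine's input) as the route does: a cuspidal `π` on `GL₂(𝔸_M)` of
WEIGHT ZERO (`AutomorphicRepData.HasWeightZero`: cohomological for the TRIVIAL coefficient system), unramified and
`ι`-ordinary at `w ∣ 3`, with `ι⁻¹ a_w(π) ≡ tr τ₃(Frob_w)` for a.e. `w`.  Over the fields of this ladder — `M`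
cyclic of degree `2m`, `m` odd squarefree, `3` split in the quadratic subfield — every `w ∣ 3` has ODD
ramification index `e(w∣3) ∈ {1} ∪ {ℓ : ℓ ∣ m}`, and then NO such `π` exists once `τ₃` is unramified at
`w ∣ 3` (which the door demands): the Galois representation `ρ_{π,ι} : Γ_M → GL₂(ℚ̄₃)` of a weight-zero
cuspidal `π` (Harris–Lan–Taylor–Thorne, Scholze) has `det ρ_{π,ι} = ε⁻¹ · ψ` with `ψ` of finite order and
unramified wherever `π` is (read off the Frobenius polynomials `X² − a_w X + q_w ω_π(ϖ_w)` at unramified `w`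
and Chebotarev), so `det ρ̄_{π,ι}|_{I_w} = ω⁻¹|_{I_w}` (`ω` = mod-`3` cyclotomic character), which is
NON-TRIVIAL exactly when `e(w∣3)` is odd (`ω` has order `2 = 3 − 1` on `I_{ℚ₃}`); whereas the a.e. trace
congruence and Brauer–Nesbitt from traces (`p = 3 > n = 2`) give `ρ̄_{π,ι}^{ss} ≅ τ̄₃^{ss}`, so
`det ρ̄_{π,ι} = det τ̄₃` is UNRAMIFIED at `w`.  Contradiction.  (Classically: a mod-`p` representation
unramified at `p` is ordinarily modular only in weights `k ≡ 1 (mod p−1)` — `k = 1, p, 2p−1, …` — never in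
weight `2` for `p > 2`: Serre 1987 §2.3, Edixhoven 1992 Thm 4.5; Buzzard–Diamond–Jarvis 2010 over totally real
fields.)  Hence v2b's `CofinalSplitDoor` was FALSE as soon as one admissible `σ` exists, its
`ShapePreservingEngine` had an unsatisfiable hypothesis, and the landed split — every theorem of it true — was
VACUOUS at D∞.  [For the critic, outside this node: the route's single-field door `CMOrdinaryDoor` (14076) and the
hypothesis of `ProAutomorphyAtKleinPrime` (14074) escape the same computation only over fields `M` with
`e(w∣3)` EVEN at every `w ∣ 3`; with `3` split in `ℚ(√-d) ⊆ M` that forces `M/ℚ(√-d)` evenly ramified above `3`.]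
REPAIR.  Hida theory makes the weight of the residual witness irrelevant: what Λ-adic ordinary patching
(KhareThorne2017 Thm 6.30; ACC⁺ §6) consumes is a non-Eisenstein maximal ideal `𝔪` of the completed-cohomology
Hecke algebra `𝕋(U^p)` with `ρ̄_𝔪 ≅ τ̄₃` — any weight, torsion allowed — and its output `IsPadicallyAutomorphic`
already lives in that algebra.  v3 types the door's output and the engine's input in exactly this RESIDUAL
currency (`TameLevel.IsNonEisenstein`, `TameLevel.IsResidualRepAt`, `FramedGaloisRep.IsReductionOf`: the
vocabulary of `IsPadicallyAutomorphic.exists_isResidualRepAt`, GeeNewton2020 §3.3), which is also the currency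
of Serre-type conjectures over CM fields (Figueiredo 1999; Torrey 2012; Şengün arXiv:1204.6697 §11.1, who records
that for restrictions of EVEN `ρ̄` the matching eigensystems are expected to be TORSION — the `163`-example —
so that no characteristic-0 trivial-weight formulation should be asked for at all; CalegariVenkatesh
arXiv:1212.3847 for the torsion paradigm).  The glue `langlands_of_pieces` is unchanged: the residual clause is
handed from D∞ to E∞ verbatim.

## Pieces (tags relative to the route's items; all `Prop`s over existing declarations)

* `CofinalResidualDoor` (D∞, v3) — the door in RESIDUAL currency, INCOMPARABLE with `CMOrdinaryDoor` (14076):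
  for a.e. `p`, over a CM field `M_p` that is CYCLIC over `ℚ` of SQUAREFREE degree with odd prime divisors in
  `[2^p, 2^{p+1})`, `p` split completely, imaginary quadratic subfield `ℚ(√-d)`, `d ≡ 2 (3)`, `ζ₃ ∉ M_p`: a
  character `χ`, `τ = χ ⊗ σ|_M`, a `3`-adic model `τ₃` of finite image (projective image `A₅`, unramified and
  `3`-distinguished at `w ∣ 3`, `χ`, `τ₃` unramified above `p`) that is RESIDUALLY AUTOMORPHIC IN COMPLETED
  COHOMOLOGY: some tame level `𝒰` of `GL₂/M_p` carries a non-Eisenstein maximal ideal `𝔪 ⊂ 𝕋(U^p)` whose residual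
  representation `ρ̄_𝔪` (`TameLevel.IsResidualRepAt`) is a reduction of `τ₃` (`FramedGaloisRep.IsReductionOf`) —
  any weight, torsion allowed.  Leaf: IDEA-NEEDED (an instance of Serre's modularity conjecture over CM fields,
  torsion formulation, for the restriction of an EVEN `ρ̄`; § Obstruction explains why the characteristic-0
  weight-zero formulation of v2 had to go).
* `ShapePreservingResidualEngine` (E∞, v3) — VARIANT-ASK of `ProAutomorphyAtKleinPrime` (14074) with the
  residual-automorphy INPUT in the same currency as its OUTPUT (`IsPadicallyAutomorphic`): `M` of the shape,
  `τ₃` as above residually automorphic in completed cohomology ⟹ over a soluble CM `M' ⊇ M` OF THE SAME SHAPE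
  (cyclic, squarefree, window, `p` split) `τ₃|_{M'}` keeps projective image `A₅` and is `3`-adically automorphic
  at a tame level unramified above `p`.  Intended proof: ordinary part at `𝔪` (`τ̄₃|_{Γ_w}` unramified with
  distinct eigenvalues at `w ∣ 3` — weight part of Serre / companion forms, torsion version) then Λ-adic
  ordinary patching `R^{ord}_{τ̄₃} ↠ 𝕋(U^p)^{ord}_𝔪` with nilpotent kernel (KhareThorne2017 Thm 6.30, ACC⁺ §5–6,
  CaraianiNewton2023).  Leaf: INSTRUMENTABLE-to-NEEDS-BREAKTHROUGH (torsion weight/level optimisation over CM;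
  LGC at `w ∣ 3` for ordinary completed cohomology, KT17 Conj. 6.28).
* F∞ `ClassicalityOffBadPlaces`, G∞ `UntwistAutomorphyAt` (THEOREM), H∞ `CofinalCyclicDescent`, `NonDistinguishedComplement`
  (14078) and `SectorJunction` (13565): UNCHANGED — see the v2b module `Theorems.SplitPrimeDescentLadder` and its docstring.

Deciding theorems: `langlands_of_pieces_residual : D∞' → E∞' → F∞ → G∞ → H∞ → NonDistinguishedComplement → SectorJunction →
Langlands` and, with the decided leaf G∞ discharged, `closes_target_residual : D∞' → E∞' → F∞ → H∞ →
NonDistinguishedComplement → SectorJunction → Langlands` (0 sorry; glue unchanged from v2b: the residual clause is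
handed from D∞' to E∞' whole).
-/

set_option linter.dupNamespace false -- project-wide option; `Summit.Langlands.Langlands` is the mandated namespace
noncomputable section
namespace Summit.Langlands.Langlands.Theorems.SplitPrimeDescentLadder
open Summit.Langlands.Langlands.Theses.EvenIcosahedralCMCorner

/-- **D∞ `CofinalResidualDoor`** (v3) — the door in residual currency, INCOMPARABLE with
`EvenIcosahedralCMCorner.CMOrdinaryDoor` (`stmt-Langlands-14076`, characteristic-0 weight-zero currency — see the
module docstring, § Obstruction); leaf IDEA-NEEDED (door).  For an irreducible even icosahedral `σ` that is
unramified and `3`-distinguished at `3`: for ALL BUT FINITELY MANY rational primes `p` there is a Galois CM field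
`M` with `Gal(M/ℚ)` cyclic of squarefree order whose odd prime divisors lie in `[2^p, 2^{p+1})`, `p` split
completely in `M`, imaginary quadratic subfield `ℚ(√-d)` with `d ≡ 2 (mod 3)`, `ζ₃ ∉ M`, a character `χ` and
`τ = χ ⊗ σ|_M` with a `3`-adic model `τ₃` of finite image, `χ` and `τ₃` unramified above `p`, `τ₃` of projective
image `A₅`, unramified and `3`-distinguished at `w ∣ 3`, and RESIDUALLY AUTOMORPHIC IN COMPLETED COHOMOLOGY: a tame
level `𝒰` of `GL₂/M`, a non-Eisenstein maximal ideal `𝔪 ⊂ 𝕋(U^p)` and a residual representation `ρ̄_𝔪`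
(`TameLevel.IsResidualRepAt`) that is a reduction of `τ₃` (`FramedGaloisRep.IsReductionOf`).  Why it might fail:
it is Serre's modularity conjecture over CM fields (torsion formulation) for `τ̄₃`, open even for one field; the
field supply (cyclic CM of the window shape with `p` and `3` split) is Dirichlet + cyclotomic and never the issue.
NOT summit-implied (an Artin `π` is non-cohomological; its trace in `𝕋(U^p)` is Hansen's Conj. 1.2.3).
[Figueiredo1999; Torrey2012; arXiv:1204.6697 §11.1; arXiv:1910.12986; EllenbergSerreF9-2005; GeeNewton2020 §3.3] -/
def CofinalResidualDoor : Prop :=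
  ∀ (ι : PadicAlgCl 3 ≃+* ℂ) (σ : Literature.NumberTheory.GaloisRepresentations.FramedGaloisRep ℚ ℂ 2), σ.toGaloisRep.IsIrreducible → Nonempty ((Matrix.ProjGenLinGroup.mk.comp σ.toMonoidHom).range ≃* alternatingGroup (Fin 5)) → (∀ (φ : ℚ →+* ℝ) (c : Field.absoluteGaloisGroup ℚ), Literature.NumberTheory.GaloisRepresentations.IsComplexConjugation φ c → Matrix.GeneralLinearGroup.det (σ c) = 1) → (∀ v : IsDedekindDomain.HeightOneSpectrum (NumberField.RingOfIntegers ℚ), (3 : NumberField.RingOfIntegers ℚ) ∈ v.asIdeal → σ.IsUnramifiedAt v ∧ ∃ t d : ℂ, σ.HasFrobCharpolyAt v (Polynomial.X ^ 2 - Polynomial.C t * Polynomial.X + Polynomial.C d) ∧ t ^ 2 ≠ d ∧ t ^ 2 ≠ 4 * d) → ∀ᶠ p : IsDedekindDomain.HeightOneSpectrum (NumberField.RingOfIntegers ℚ) in Filter.cofinite, ∃ (M : Type) (_ : Field M) (_ : NumberField M), NumberField.IsCMField M ∧ IsGalois ℚ M ∧ IsCyclic (M ≃ₐ[ℚ] M)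 ∧ Squarefree (Module.finrank ℚ M) ∧ (∀ ℓ : ℕ, ℓ.Prime → ℓ ∣ Module.finrank ℚ M → ℓ = 2 ∨ (2 ^ Ideal.absNorm p.asIdeal ≤ ℓ ∧ ℓ < 2 ^ (Ideal.absNorm p.asIdeal + 1))) ∧ (∀ w : IsDedekindDomain.HeightOneSpectrum (NumberField.RingOfIntegers M), w.asIdeal.under (NumberField.RingOfIntegers ℚ) = p.asIdeal → w.asIdeal.inertiaDeg (NumberField.RingOfIntegers ℚ) = 1 ∧ w.asIdeal.ramificationIdx (NumberField.RingOfIntegers ℚ) = 1) ∧ (∃ (d : ℕ) (z : M), d % 3 = 2 ∧ z ^ 2 + (d : M) = 0) ∧ (∀ z : M, z ^ 2 + z + 1 ≠ 0) ∧ ∃ (χ : Literature.NumberTheory.GaloisRepresentations.FramedGaloisRep M ℂ 1) (τ : Literature.NumberTheory.GaloisRepresentations.FramedGaloisRep M ℂ 2) (τ₃ : Literature.NumberTheory.GaloisRepresentations.FramedGaloisRep M (PadicAlgCl 3) 2), (∀ g : Field.absoluteGaloisGroup M, ((τ g : Matrix.GeneralLinearGroup (Fin 2) ℂ) : Matrix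 (Fin 2) (Fin 2) ℂ) = ((Matrix.GeneralLinearGroup.det (χ g) : ℂˣ) : ℂ) • ((Literature.NumberTheory.GaloisRepresentations.FramedGaloisRep.restrictField M σ g : Matrix.GeneralLinearGroup (Fin 2) ℂ) : Matrix (Fin 2) (Fin 2) ℂ)) ∧ (∀ g : Field.absoluteGaloisGroup M, ((τ₃ g : Matrix.GeneralLinearGroup (Fin 2) (PadicAlgCl 3)) : Matrix (Fin 2) (Fin 2) (PadicAlgCl 3)).map ι = ((τ g : Matrix.GeneralLinearGroup (Fin 2) ℂ) : Matrix (Fin 2) (Fin 2) ℂ)) ∧ Finite τ₃.toMonoidHom.range ∧ (∀ w : IsDedekindDomain.HeightOneSpectrum (NumberField.RingOfIntegers M), w.asIdeal.under (NumberField.RingOfIntegers ℚ) = p.asIdeal → χ.IsUnramifiedAt w ∧ τ₃.IsUnramifiedAt w) ∧ (Nonempty ((Matrix.ProjGenLinGroup.mk.comp τ₃.toMonoidHom).range ≃* alternatingGroup (Fin 5)) ∧ (∀ w : IsDedekindDomain.HeightOneSpectrum (NumberField.RingOfIntegers M), (3 : NumberField.RingOfIntegers M) ∈ w.asIdeal →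 τ₃.IsUnramifiedAt w ∧ ∃ t d : PadicAlgCl 3, τ₃.HasFrobCharpolyAt w (Polynomial.X ^ 2 - Polynomial.C t * Polynomial.X + Polynomial.C d) ∧ ‖t ^ 2 - 4 * d‖ = 1) ∧ ∃ 𝒰 : Literature.NumberTheory.Automorphic.BigHeckeGLn.TameLevel 2 M 3, ∃ 𝔪 : Ideal (Literature.NumberTheory.Automorphic.CompletedCohomologyHeckeAlgebraGLn 𝒰), 𝒰.IsNonEisenstein 𝔪 ∧ ∃ (k : Type) (_ : Field k) (_ : TopologicalSpace k) (_ : DiscreteTopology k) (ιk : Literature.NumberTheory.GaloisRepresentations.padicAlgClResidueField 3 →+* k) (ψ : Literature.NumberTheory.Automorphic.CompletedCohomologyHeckeAlgebraGLn 𝒰 →+* k) (ρ : Literature.NumberTheory.GaloisRepresentations.FramedGaloisRep M k 2), 𝒰.IsResidualRepAt 𝔪 ψ ρ ∧ τ₃.IsReductionOf ιk (ρ : Field.absoluteGaloisGroup M →* Matrix.GeneralLinearGroup (Fin 2) k))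

/-- **E∞ `ShapePreservingResidualEngine`** (v3) — VARIANT-ASK of `EvenIcosahedralCMCorner.ProAutomorphyAtKleinPrime`
(`stmt-Langlands-14074`) with the residual-automorphy input in the currency of the output; leaf INSTRUMENTABLE-to-
NEEDS-BREAKTHROUGH (engine).  `M` Galois CM, cyclic of squarefree degree with odd prime divisors in `[2^p, 2^{p+1})`,
`p` split completely, `ℚ(√-d) ⊆ M` with `d ≡ 2 (3)`, `ζ₃ ∉ M`; `τ₃ : Γ_M → GL₂(ℚ̄₃)` of finite image, unramified
above `p`, projective image `A₅`, unramified and `3`-distinguished at `w ∣ 3`, residually automorphic in completed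
cohomology at some tame level (non-Eisenstein `𝔪`, `ρ̄_𝔪` a reduction of `τ₃`).  THEN over some CM `M' ⊇ M` OF THE
SAME SHAPE (Galois, cyclic, squarefree, window, `p` split completely) `τ₃|_{M'}` has finite image and projective
image `A₅` and is `3`-adically automorphic (`TameLevel.IsPadicallyAutomorphic`) at a tame level UNRAMIFIED ABOVE `p`.
Intended proof: ordinary part at `𝔪` (torsion weight part of Serre at `w ∣ 3`), level optimisation away from `p`
(torsion level lowering — `τ₃` is unramified above `p`), then Λ-adic ordinary patching of ordinary completed
cohomology, KhareThorne2017 Thm 6.30 made unconditional where ACC⁺ §5–6 / CaraianiNewton2023 reach; allowable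
base changes = cyclic layers of fresh prime degree in the window inside `ℚ(ζ_q)` with `p` an `ℓ`-th power mod `q`.
Why it might fail: KT17 Thm 6.30 is conditional on Λ-adic LGC at `w ∣ 3` (Conj. 6.28); torsion level lowering and
the torsion weight part over CM fields are open (CalegariVenkatesh arXiv:1212.3847 §§4–6).  NOT summit-implied.
[KhareThorne2017; ACCGHLNSTT2023; CaraianiNewton2023; arXiv:1212.3847; arXiv:1409.7007] -/
def ShapePreservingResidualEngine : Prop :=
  ∀ (M : Type) [Field M] [NumberField M] (p : IsDedekindDomain.HeightOneSpectrum (NumberField.RingOfIntegers ℚ)), NumberField.IsCMField M → IsGalois ℚ M → IsCyclic (M ≃ₐ[ℚ] M) → Squarefree (Module.finrank ℚ M) → (∀ ℓ : ℕ, ℓ.Prime → ℓ ∣ Module.finrank ℚ M → ℓ = 2 ∨ (2 ^ Ideal.absNorm p.asIdeal ≤ ℓ ∧ ℓ < 2 ^ (Ideal.absNorm p.asIdeal + 1))) → (∀ w : IsDedekindDomain.HeightOneSpectrum (NumberField.RingOfIntegers M), w.asIdeal.under (NumberField.RingOfIntegers ℚ) = p.asIdeal → w.asIdeal.inertiaDeg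 (NumberField.RingOfIntegers ℚ) = 1 ∧ w.asIdeal.ramificationIdx (NumberField.RingOfIntegers ℚ) = 1) → (∃ (d : ℕ) (z : M), d % 3 = 2 ∧ z ^ 2 + (d : M) = 0) → (∀ z : M, z ^ 2 + z + 1 ≠ 0) → ∀ τ₃ : Literature.NumberTheory.GaloisRepresentations.FramedGaloisRep M (PadicAlgCl 3) 2, Finite τ₃.toMonoidHom.range → (∀ w : IsDedekindDomain.HeightOneSpectrum (NumberField.RingOfIntegers M), w.asIdeal.under (NumberField.RingOfIntegers ℚ) = p.asIdeal → τ₃.IsUnramifiedAt w) → (Nonempty ((Matrix.ProjGenLinGroup.mk.comp τ₃.toMonoidHom).range ≃* alternatingGroup (Fin 5)) ∧ (∀ w : IsDedekindDomain.HeightOneSpectrum (NumberField.RingOfIntegers M), (3 : NumberField.RingOfIntegers M) ∈ w.asIdeal → τ₃.IsUnramifiedAt w ∧ ∃ t d : PadicAlgCl 3, τ₃.HasFrobCharpolyAt w (Polynomial.X ^ 2 - Polynomial.C t * Polynomial.X + Polynomial.C d) ∧ ‖t ^ 2 - 4 * d‖ = 1) ∧ ∃ 𝒰 : Literature.NumberTheory.Automorphic.BigHeckeGLn.TameLevel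 2 M 3, ∃ 𝔪 : Ideal (Literature.NumberTheory.Automorphic.CompletedCohomologyHeckeAlgebraGLn 𝒰), 𝒰.IsNonEisenstein 𝔪 ∧ ∃ (k : Type) (_ : Field k) (_ : TopologicalSpace k) (_ : DiscreteTopology k) (ιk : Literature.NumberTheory.GaloisRepresentations.padicAlgClResidueField 3 →+* k) (ψ : Literature.NumberTheory.Automorphic.CompletedCohomologyHeckeAlgebraGLn 𝒰 →+* k) (ρ : Literature.NumberTheory.GaloisRepresentations.FramedGaloisRep M k 2), 𝒰.IsResidualRepAt 𝔪 ψ ρ ∧ τ₃.IsReductionOf ιk (ρ : Field.absoluteGaloisGroup M →* Matrix.GeneralLinearGroup (Fin 2) k)) → ∃ (M' : Type) (_ : Field M') (_ : NumberField M') (_ : Algebra M M'), NumberField.IsCMField M' ∧ IsGalois ℚ M' ∧ IsCyclic (M' ≃ₐ[ℚ] M') ∧ Squarefree (Module.finrank ℚ M') ∧ (∀ ℓ : ℕ, ℓ.Prime → ℓ ∣ Module.finrank ℚ M' → ℓ = 2 ∨ (2 ^ Ideal.absNorm p.asIdeal ≤ ℓ ∧ ℓ < 2 ^ (Ideal.absNorm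 p.asIdeal + 1))) ∧ (∀ w : IsDedekindDomain.HeightOneSpectrum (NumberField.RingOfIntegers M'), w.asIdeal.under (NumberField.RingOfIntegers ℚ) = p.asIdeal → w.asIdeal.inertiaDeg (NumberField.RingOfIntegers ℚ) = 1 ∧ w.asIdeal.ramificationIdx (NumberField.RingOfIntegers ℚ) = 1) ∧ Finite (Literature.NumberTheory.GaloisRepresentations.FramedGaloisRep.restrictField M' τ₃).toMonoidHom.range ∧ Nonempty ((Matrix.ProjGenLinGroup.mk.comp (Literature.NumberTheory.GaloisRepresentations.FramedGaloisRep.restrictField M' τ₃).toMonoidHom).range ≃* alternatingGroup (Fin 5)) ∧ ∃ 𝒰 : Literature.NumberTheory.Automorphic.BigHeckeGLn.TameLevel 2 M' 3, (∀ w : IsDedekindDomain.HeightOneSpectrum (NumberField.RingOfIntegers M'), w.asIdeal.under (NumberField.RingOfIntegers ℚ) = p.asIdeal → w ∉ 𝒰.bad) ∧ 𝒰.IsPadicallyAutomorphic (Literature.NumberTheory.GaloisRepresentations.FramedGaloisRep.restrictField M' τ₃)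

open scoped MatrixGroups
open NumberField IsDedekindDomain Filter
open Literature.NumberTheory.GaloisRepresentations Literature.NumberTheory.Automorphic

/-! ### The deciding theorems of the node (v3; `_residual` names forced by the append-only rule — v2b owns the bare names) -/

/-- **`langlands_of_pieces_residual`** — the node's deciding theorem: the five pieces, the route's residual complement
and its junction imply `Langlands`.  Same architecture as `EvenIcosahedralCMCorner.closes`; in the
`3`-distinguished branch the descent hypothesis `CofinalCyclicDescent` is fed, prime by prime along the
cofinite filter delivered by the door, by engine → wall → pointwise untwist, the matching ABOVE `p` being
carried by the tame level (`w ∉ 𝒰.bad`) and the unramifiedness of `χ` above `p`. -/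
theorem langlands_of_pieces_residual (hD : CofinalResidualDoor) (hE : ShapePreservingResidualEngine) (hF : ClassicalityOffBadPlaces)
    (hG : UntwistAutomorphyAt) (hH : CofinalCyclicDescent) (hC : NonDistinguishedComplement)
    (hJ : SectorJunction) : _root_.Langlands := by
  obtain ⟨ι⟩ := PadicAlgCl.nonempty_ringEquiv_complex 3
  refine hJ fun σ hirr hico heven ↦ ?_
  by_cases h3 : ∀ v : IsDedekindDomain.HeightOneSpectrum (NumberField.RingOfIntegers ℚ), (3 : NumberField.RingOfIntegers ℚ) ∈ v.asIdeal → σ.IsUnramifiedAt v ∧ ∃ t d : ℂ, σ.HasFrobCharpolyAt v (Polynomial.X ^ 2 - Polynomial.C t * Polynomial.X + Polynomial.C d) ∧ t ^ 2 ≠ d ∧ t ^ 2 ≠ 4 * d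
  · -- the 3-distinguished sub-sector: cofinal door → engine → wall → pointwise untwist, prime by prime
    refine hH σ hirr hico ?_
    filter_upwards [hD ι σ hirr hico heven h3] with p hp
    obtain ⟨M, _, _, hCM, hGal, hCyc, hSq, hWin, hSplit, hK3, hζ, χ, τ, τ₃, htw, hav, hfin, hunr, hhyp⟩ := hp
    obtain ⟨M', _, _, _, hCM', hGal', hCyc', hSq', hWin', hSplit', hfin', hico', 𝒰, hbad, hpa⟩ :=
      hE M p hCM hGal hCyc hSq hWin hSplit hK3 hζ τ₃ hfin (fun w hw ↦ (hunr w hw).2) hhyp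
    obtain ⟨hM'c, π', hae, hpt⟩ := hF ι M' hCM' (τ.restrictField M') (τ₃.restrictField M')
      (fun g ↦ hav _) hfin' hico' 𝒰 hpa
    -- `χ|_{M'}` is unramified above `p`
    have hT : ∀ w' ∈ {w' : HeightOneSpectrum (𝓞 M') | w'.asIdeal.under (𝓞 ℚ) = p.asIdeal},
        (χ.restrictField M').IsUnramifiedAt w' := by
      intro w' hw'
      obtain ⟨w, hw⟩ := exists_under_eq (F := M) w'
      have hwp : w.asIdeal.under (𝓞 ℚ) = p.asIdeal := by
        rw [← hw, Ideal.under_under]; exact hw'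
      exact χ.isUnramifiedAt_restrictField hw (hunr w hwp).1
    obtain ⟨hM'', π'', hae', hpt'⟩ := hG M' ((σ.restrictField M).restrictField M') (τ.restrictField M')
      (χ.restrictField M') {w' | w'.asIdeal.under (𝓞 ℚ) = p.asIdeal} (fun g ↦ htw _) hT
      ⟨hM'c, π', hae, fun w' hw' ↦ hpt w' (hbad w' hw')⟩
    exact ⟨M, inferInstance, inferInstance, M', inferInstance, inferInstance, inferInstance, hCM', hGal', hCyc', hSq',
      hWin', hSplit', hM'', π'', hae', fun w' hw' ↦ hpt' w' hw'⟩
  · exact hC σ hirr hico heven h3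

/-- **`closes_target_residual`** — the deciding theorem with the decided leaf G∞ discharged in kernel:
FOUR open pieces (D∞, E∞, F∞, H∞) plus the route's residual and junction imply `Langlands`. -/
theorem closes_target_residual (hD : CofinalResidualDoor) (hE : ShapePreservingResidualEngine) (hF : ClassicalityOffBadPlaces)
    (hH : CofinalCyclicDescent) (hC : NonDistinguishedComplement) (hJ : SectorJunction) : _root_.Langlands :=
  langlands_of_pieces_residual hD hE hF untwistAutomorphyAt_proof hH hC hJ

end Summit.Langlands.Langlands.Theorems.SplitPrimeDescentLadder

end
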